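/-
VALUE = THEOREM, NOT summit progress (cell b2b-lgcu-borel, gen 22); crux 14079 untouched.
-/
import Mathlib
import Summits.MatrixMultiplication.MatrixMultiplication.Theorems.LieRankDesigns.Negative.Basics

/-!
# Summand transport: identity designs restrict along `g ↦ g ⊕ 1 : GL_n(𝔽_p) → GL_m(𝔽_p)`
(every `n ≤ m`, every level `k`, every coordinate embedding)

VALUE = THEOREM (bookkeeping that makes every low-dimensional exclusion valid in ALL dimensions),
NOT summit progress.  The crux `SubgroupIdentityDesigns` (stmt-MatrixMultiplication-14079) is
untouched.

`DesignConjGL.lean` (gen 21) made the identity-design clause of the crux invariant under simultaneous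
conjugation and monotone in the triple.  This file adds the third transport: RESTRICTION TO A
DIRECT SUMMAND.  Fix a decomposition of the coordinates `e : Fin n ⊕ Fin l ≃ Fin m` and the block
embedding `emb e : GL_n(𝔽_p) →* GL_m(𝔽_p)`, `g ↦ g ⊕ 1_l` (`g` on the `n` chosen coordinates, the
identity on the other `l`).  If `c : Mat_m(𝔽_p) → ℂ` is a level-`k` identity design for
`(H₁,H₂,H₃) ≤ GL_m(𝔽_p)`, then the RESTRICTED FOURIER TABLE
`c'(N) = Σ_{M : M|₁₁ = N} c(M) ψ(tr M|₂₂)` is a level-`k` identity design for the pulled-back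
triple `(emb⁻¹H₁, emb⁻¹H₂, emb⁻¹H₃) ≤ GL_n(𝔽_p)` (`design_restrict`, `design_comap`):
`tr(M · (g ⊕ 1)) = tr(M|₁₁ g) + tr(M|₂₂)` (`trace_mul_embMat`) gives
`Σ_N c'(N) ψ(tr(N g)) = Σ_M c(M) ψ(tr(M · emb g))` (`fourier_restrict`), and `rk M|₁₁ ≤ rk M`
keeps the level.

CONSEQUENCE (`no_design_of_emb_le`): every coordinate exclusion proved in a FIXED dimension `n`
("no triple of `GL_n(𝔽_p)` with `Kᵢ ≤ Hᵢ` carries a level-`k` identity design") holds in EVERY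
dimension `m ≥ n` for the block-embedded configuration `emb e (Kᵢ) ≤ Hᵢ`, for every choice of
the `n` coordinates (any `e`), and — with `DesignConjGL` — in every frame.  In particular all
`m = 3` member exclusions of gen 21 (ReflectedTranslation, its dual, DihedralUnipotent,
DihedralRoot) and the `GL₂` single-member criteria (Fixers, DetFixers, …) exclude the groups
`K ⊕ 1_{m-n}` from the members of a level-one design in `GL_m(𝔽_p)` for all `m ≥ n`.  (A group
`K ≤ GL_n` and `K ⊕ 1 ≤ GL_m` have the same vector stabilisers, so non-carriers stay non-carriers:
this is the design-level form of that remark, valid also across members and at every level.)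

HONEST SCOPE.  Pure transport; proves no new exclusion by itself.  Subgroup TPP also pulls back
along the injective hom `emb e` (not needed here); the graded budget does NOT (it depends on `m`),
so only TPP-free, budget-free exclusions transport.
-/

set_option linter.dupNamespace false

noncomputable section

open scoped BigOperators Matrix Classical
open Summit.MatrixMultiplication.MatrixMultiplication.Theorems.LieRankDesigns.Negative (GLm Mat)

namespace Summit.MatrixMultiplication.MatrixMultiplication.Theorems.SubgroupIdentityDesigns.Negative
namespace SummandTransport

variable {p n l m : ℕ} (e : Fin n ⊕ Fin l ≃ Fin m)

/-! ## The block embedding `g ↦ g ⊕ 1` -/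

/-- The matrix `g ⊕ 1_l`, placed on the coordinates chosen by `e`. -/
def embMat (N : Mat p n) : Mat p m :=
  (Matrix.fromBlocks N 0 0 (1 : Mat p l)).submatrix e.symm e.symm

/-- Entries of `embMat` in the `e`-coordinates. -/
@[simp] theorem embMat_apply (N : Mat p n) (x y : Fin n ⊕ Fin l) :
    embMat e N (e x) (e y) = Matrix.fromBlocks N 0 0 (1 : Mat p l) x y := by
  simp [embMat]

/-- `embMat` is multiplicative. -/
theorem embMat_mul (N N' : Mat p n) : embMat e (N * N') = embMat e N * embMat e N' := by
  unfold embMat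
  rw [Matrix.submatrix_mul_equiv, Matrix.fromBlocks_multiply]
  simp

/-- `embMat 1 = 1`. -/
theorem embMat_one : embMat e (1 : Mat p n) = 1 := by
  unfold embMat
  rw [Matrix.fromBlocks_one, Matrix.submatrix_one_equiv]

/-- `embMat` as a monoid homomorphism `Mat_n → Mat_m`. -/
def embMatHom : Mat p n →* Mat p m where
  toFun := embMat e
  map_one' := embMat_one e
  map_mul' := embMat_mul e

/-- **The block embedding** `emb e : GL_n(𝔽_p) →* GL_m(𝔽_p)`, `g ↦ g ⊕ 1` on the coordinates `e`. -/
def emb : GLm p n →* GLm p m := Units.map (embMatHom e)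

/-- Underlying matrix of `emb e g`. -/
@[simp] theorem coe_emb (g : GLm p n) : ((emb e g : GLm p m) : Mat p m) = embMat e (g : Mat p n) :=
  rfl

/-- `embMat` is injective. -/
theorem embMat_injective : Function.Injective (embMat (p := p) e) := by
  intro N N' h
  ext i j
  have := congrFun (congrFun h (e (Sum.inl i))) (e (Sum.inl j))
  simpa using this

/-- `emb e` is injective. -/
theorem emb_injective : Function.Injective (emb (p := p) e) := by
  intro g g' h
  apply Units.ext
  exact embMat_injective e (congrArg (fun x : GLm p m => (x : Mat p m)) h)

/-- `emb e g = 1 ↔ g = 1`. -/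
theorem emb_eq_one_iff (g : GLm p n) : emb e g = 1 ↔ g = 1 := by
  constructor
  · intro h
    exact emb_injective e (by rw [h, map_one])
  · rintro rfl; exact map_one _

/-! ## Diagonal blocks of a matrix of `Mat_m` in the `e`-coordinates -/

/-- The upper-left `n × n` block `M|₁₁`. -/
def res (M : Mat p m) : Mat p n := M.submatrix (fun i => e (Sum.inl i)) (fun j => e (Sum.inl j))

/-- The lower-right `l × l` block `M|₂₂`. -/
def cor (M : Mat p m) : Mat p l := M.submatrix (fun i => e (Sum.inr i)) (fun j => e (Sum.inr j))

/-- `rk M|₁₁ ≤ rk M`. -/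
theorem rank_res_le [Fact p.Prime] (M : Mat p m) : (res e M).rank ≤ M.rank :=
  Matrix.rank_submatrix_le M _ _

/-- **Trace formula**: `tr(M · (g ⊕ 1)) = tr(M|₁₁ g) + tr(M|₂₂)`. -/
theorem trace_mul_embMat (M : Mat p m) (N : Mat p n) :
    Matrix.trace (M * embMat e N) = Matrix.trace (res e M * N) + Matrix.trace (cor e M) := by
  simp only [Matrix.trace, Matrix.diag, Matrix.mul_apply]
  -- reindex both sums over `Fin m` along `e`
  rw [← e.sum_comp]
  have hin : ∀ x : Fin n ⊕ Fin l,
      (∑ j : Fin m, M (e x) j * embMat e N j (e x)) =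
        ∑ y : Fin n ⊕ Fin l, M (e x) (e y) * Matrix.fromBlocks N 0 0 (1 : Mat p l) y x := by
    intro x
    rw [← e.sum_comp]
    simp only [embMat_apply]
  simp only [hin, Fintype.sum_sum_type, Matrix.fromBlocks_apply₁₁, Matrix.fromBlocks_apply₁₂,
    Matrix.fromBlocks_apply₂₁, Matrix.fromBlocks_apply₂₂, Matrix.zero_apply, mul_zero,
    Finset.sum_const_zero, add_zero, zero_add, res, cor, Matrix.submatrix_apply]
  congr 1
  refine Finset.sum_congr rfl fun a _ => ?_
  simp [Matrix.one_apply]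

/-! ## Coordinates: `emb e g` fixes the complementary coordinates and acts as `g` on the chosen ones -/

/-- `(g ⊕ 1) v` on a chosen coordinate: `(emb g · v)_{e(inl i)} = Σ_j g i j v_{e(inl j)}`. -/
theorem embMat_mulVec_inl (N : Mat p n) (v : Fin m → ZMod p) (i : Fin n) :
    (embMat e N *ᵥ v) (e (Sum.inl i)) = ∑ j : Fin n, N i j * v (e (Sum.inl j)) := by
  simp only [Matrix.mulVec, dotProduct]
  rw [← e.sum_comp]
  simp [Fintype.sum_sum_type]

/-- `(g ⊕ 1) v` on a complementary coordinate: unchanged. -/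
theorem embMat_mulVec_inr (N : Mat p n) (v : Fin m → ZMod p) (i : Fin l) :
    (embMat e N *ᵥ v) (e (Sum.inr i)) = v (e (Sum.inr i)) := by
  simp only [Matrix.mulVec, dotProduct]
  rw [← e.sum_comp]
  simp [Fintype.sum_sum_type, Matrix.one_apply]

/-! ## Restricting a Fourier table -/

variable [hp : Fact p.Prime]

/-- The restricted Fourier table `c'(N) = Σ_{M : M|₁₁ = N} c(M) ψ(tr M|₂₂)`. -/
def restrictFourier (c : Mat p m → ℂ) : Mat p n → ℂ := fun N =>
  ∑ M : Mat p m, if res e M = N then c M * ZMod.stdAddChar (Matrix.trace (cor e M)) else 0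

/-- **Fourier restriction**: `Σ_N c'(N) ψ(tr(N s)) = Σ_M c(M) ψ(tr(M · (s ⊕ 1)))`. -/
theorem fourier_restrict (c : Mat p m → ℂ) (s : Mat p n) :
    (∑ N : Mat p n, restrictFourier e c N * ZMod.stdAddChar (Matrix.trace (N * s))) =
      ∑ M : Mat p m, c M * ZMod.stdAddChar (Matrix.trace (M * embMat e s)) := by
  simp only [restrictFourier, Finset.sum_mul]
  rw [Finset.sum_comm]
  refine Finset.sum_congr rfl fun M _ => ?_
  simp only [ite_mul, zero_mul, Finset.sum_ite_eq, Finset.mem_univ, if_true]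
  rw [trace_mul_embMat, AddChar.map_add_eq_mul]
  ring

/-- The restricted table keeps the level: `c = 0` above rank `k` ⇒ `c' = 0` above rank `k`. -/
theorem restrictFourier_rank {k : ℕ} {c : Mat p m → ℂ} (hc : ∀ M, k < M.rank → c M = 0)
    (N : Mat p n) (hN : k < N.rank) : restrictFourier e c N = 0 := by
  refine Finset.sum_eq_zero fun M _ => ?_
  by_cases h : res e M = N
  · have hM : k < M.rank := lt_of_lt_of_le (h ▸ hN) (rank_res_le e M)
    rw [if_pos h, hc M hM, zero_mul]
  · rw [if_neg h]

/-! ## The transport theorems -/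

/-- **SUMMAND TRANSPORT.**  If `emb e (Kᵢ) ≤ Hᵢ` (`i = 1,2,3`), a level-`k` identity design for
`(H₁,H₂,H₃) ≤ GL_m(𝔽_p)` restricts to one for `(K₁,K₂,K₃) ≤ GL_n(𝔽_p)`. -/
theorem design_restrict (k : ℕ) {H₁ H₂ H₃ : Subgroup (GLm p m)} {K₁ K₂ K₃ : Subgroup (GLm p n)}
    (hK₁ : ∀ g ∈ K₁, emb e g ∈ H₁) (hK₂ : ∀ g ∈ K₂, emb e g ∈ H₂)
    (hK₃ : ∀ g ∈ K₃, emb e g ∈ H₃)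
    (h : ∃ c : Mat p m → ℂ, (∀ M, k < M.rank → c M = 0) ∧
      (∑ M, c M * ZMod.stdAddChar (Matrix.trace (M * ((1 : GLm p m) : Mat p m)))) = 1 ∧
      ∀ a ∈ H₁, ∀ b ∈ H₂, ∀ g ∈ H₃, a * b * g ≠ 1 →
        (∑ M, c M * ZMod.stdAddChar (Matrix.trace (M * ((a * b * g : GLm p m) : Mat p m)))) = 0) :
    ∃ c : Mat p n → ℂ, (∀ M, k < M.rank → c M = 0) ∧
      (∑ M, c M * ZMod.stdAddChar (Matrix.trace (M * ((1 : GLm p n) : Mat p n)))) = 1 ∧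
      ∀ a ∈ K₁, ∀ b ∈ K₂, ∀ g ∈ K₃, a * b * g ≠ 1 →
        (∑ M, c M * ZMod.stdAddChar (Matrix.trace (M * ((a * b * g : GLm p n) : Mat p n)))) = 0 := by
  obtain ⟨c, hc, h1, h0⟩ := h
  refine ⟨restrictFourier e c, restrictFourier_rank e hc, ?_, ?_⟩
  · rw [Units.val_one, fourier_restrict, embMat_one]
    simpa only [Units.val_one] using h1
  · intro a ha b hb g hg hne
    rw [fourier_restrict]
    have hval : embMat e ((a * b * g : GLm p n) : Mat p n) =
        ((emb e a * emb e b * emb e g : GLm p m) : Mat p m) := by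
      rw [← map_mul, ← map_mul, coe_emb]
    rw [hval]
    refine h0 _ (hK₁ a ha) _ (hK₂ b hb) _ (hK₃ g hg) ?_
    rw [← map_mul, ← map_mul, Ne, emb_eq_one_iff]
    exact hne

/-- **PULL-BACK FORM.**  A level-`k` identity design for `(H₁,H₂,H₃) ≤ GL_m(𝔽_p)` restricts to one
for the preimage triple `(emb⁻¹H₁, emb⁻¹H₂, emb⁻¹H₃) ≤ GL_n(𝔽_p)`. -/
theorem design_comap (k : ℕ) {H₁ H₂ H₃ : Subgroup (GLm p m)}
    (h : ∃ c : Mat p m → ℂ, (∀ M, k < M.rank → c M = 0) ∧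
      (∑ M, c M * ZMod.stdAddChar (Matrix.trace (M * ((1 : GLm p m) : Mat p m)))) = 1 ∧
      ∀ a ∈ H₁, ∀ b ∈ H₂, ∀ g ∈ H₃, a * b * g ≠ 1 →
        (∑ M, c M * ZMod.stdAddChar (Matrix.trace (M * ((a * b * g : GLm p m) : Mat p m)))) = 0) :
    ∃ c : Mat p n → ℂ, (∀ M, k < M.rank → c M = 0) ∧
      (∑ M, c M * ZMod.stdAddChar (Matrix.trace (M * ((1 : GLm p n) : Mat p n)))) = 1 ∧
      ∀ a ∈ H₁.comap (emb e), ∀ b ∈ H₂.comap (emb e), ∀ g ∈ H₃.comap (emb e), a * b * g ≠ 1 →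
        (∑ M, c M * ZMod.stdAddChar (Matrix.trace (M * ((a * b * g : GLm p n) : Mat p n)))) = 0 :=
  design_restrict e k (fun _ hg => Subgroup.mem_comap.mp hg) (fun _ hg => Subgroup.mem_comap.mp hg)
    (fun _ hg => Subgroup.mem_comap.mp hg) h

/-- **LOW-DIMENSIONAL EXCLUSIONS HOLD IN EVERY DIMENSION.**  If NO triple `(K₁',K₂',K₃')` of
`GL_n(𝔽_p)` with `Kᵢ ≤ Kᵢ'` carries a level-`k` identity design, then no triple `(H₁,H₂,H₃)` of
`GL_m(𝔽_p)` with `emb e (Kᵢ) ≤ Hᵢ` does (any coordinate embedding `e`). -/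
theorem no_design_of_emb_le (k : ℕ) {K₁ K₂ K₃ : Subgroup (GLm p n)}
    (hex : ∀ K₁' K₂' K₃' : Subgroup (GLm p n), K₁ ≤ K₁' → K₂ ≤ K₂' → K₃ ≤ K₃' →
      ¬ ∃ c : Mat p n → ℂ, (∀ M, k < M.rank → c M = 0) ∧
        (∑ M, c M * ZMod.stdAddChar (Matrix.trace (M * ((1 : GLm p n) : Mat p n)))) = 1 ∧
        ∀ a ∈ K₁', ∀ b ∈ K₂', ∀ g ∈ K₃', a * b * g ≠ 1 →
          (∑ M, c M * ZMod.stdAddChar (Matrix.trace (M * ((a * b * g : GLm p n) : Mat p n)))) = 0)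
    {H₁ H₂ H₃ : Subgroup (GLm p m)}
    (h₁ : K₁.map (emb e) ≤ H₁) (h₂ : K₂.map (emb e) ≤ H₂) (h₃ : K₃.map (emb e) ≤ H₃) :
    ¬ ∃ c : Mat p m → ℂ, (∀ M, k < M.rank → c M = 0) ∧
      (∑ M, c M * ZMod.stdAddChar (Matrix.trace (M * ((1 : GLm p m) : Mat p m)))) = 1 ∧
      ∀ a ∈ H₁, ∀ b ∈ H₂, ∀ g ∈ H₃, a * b * g ≠ 1 →
        (∑ M, c M * ZMod.stdAddChar (Matrix.trace (M * ((a * b * g : GLm p m) : Mat p m)))) = 0 :=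
  fun h => hex _ _ _ (Subgroup.map_le_iff_le_comap.mp h₁) (Subgroup.map_le_iff_le_comap.mp h₂)
    (Subgroup.map_le_iff_le_comap.mp h₃) (design_comap e k h)

end SummandTransport
end Summit.MatrixMultiplication.MatrixMultiplication.Theorems.SubgroupIdentityDesigns.Negative
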